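import Literature.Computability.QuantumComplexity.ChainComposeUniform
import Literature.Computability.Cryptography.LWEHardness
import Literature.Probability.Moments.HoeffdingPMF
import HarnessLib

/-!
# Regev 2009, Lemma 3.5 — the loop principle with a good path: a chained family fails at most as often as the sum of its stage failures

Literature first-formalisation unit `b2b-lwe-3` (generation 6, third module), bundle
`papers/QuantumAdvantage/lwe-quantum-autopsy/`.  THE VALUE of this file is a THEOREM (the probabilistic
half of a KNOWN lemma: O. Regev, *On lattices, learning with errors, random linear codes, and
cryptography*, J. ACM 56 (2009), Lemma 3.5, whose correctness argument is "the procedure is correct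
unless one of its oracle calls errs") — NOT progress on any open problem and NOT summit progress.

## What this file proves (theorems only; no definition, no named fact, no `sorry`)

The tree's LOOP PRINCIPLE `ChainCompose.exists_chainFamily` (`QuantumComplexity/ChainCompose*.lean`;
Bernstein–Vazirani 1997 §8, Nielsen–Chuang 2010 §4.4) turns a uniform stage family `S` and polynomials
`T` (number of stages), `m` (window width) into ONE uniform family `D` whose output law dominates the law
`chainLaw 0 S.family m x T` of the window handed over after `T` adaptive stages
(`QuantumComplexity/StageChains.lean`).  Here we add the union bound along a GOOD PATH:

* `Regev2009.toOuterMeasure_bind_ne_le` — one bind: `Pr_{p ≫= K}[≠ b₀] ≤ Pr_p[≠ a₀] + Pr_{K a₀}[≠ b₀]`;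
* `Regev2009.chainLaw_toOuterMeasure_ne_le_sum` — if stage `k`, run on the good window `g k`, hands over
  the good window `g (k+1)` except with probability `≤ f k`, then after `N` stages the window differs
  from `g N` with probability `≤ Σ_{k<N} f k`; `Regev2009.one_le_chainLaw_toOuterMeasure_add_sum` — the
  complement form `1 ≤ Pr[window = g N] + Σ_{k<N} f k`;
* **`Regev2009.exists_chainFamily_goodPath`** — for a uniform stage family `S` and polynomials `T`, `m`
  there is ONE uniform family `D` such that for every input `x`, every good path `g` (`g 0 = []`) with
  real per-stage failure bounds `S.kernelProb ⟨x,⟨1ᵏ, g k⟩⟩ {w | w|_{m} ≠ g (k+1)} ≤ f k` (`k < T(|x|)`),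
  and every prefix `a` of the last good window, `1 − D.kernelProb x {z | a <+: z} ≤ Σ_{k<T(|x|)} f k`.

## How a prover of `A_lift` uses this

`A_lift = regev2009_lemma_3_5_liftFamily` (`RegevReductionCVPSplit.lean`) asks, for every digit solver
`T`, for a family `R` with `CVPOracle.failProb R I ρ k y c ≤ C · Σ_{i<p_R(n)} DigitOracle.failProb T q I ρ
k y (x_i) + ν(n)` at the true iterates `x_i`.  Take for `S` the stage family "parse the window (the
current iterate `x̃_i` and the partial sum), query `T` on `x̃_i`, read the claimed digits, hand over
`x̃_{i+1}` and the updated sum" (a classical wrap of `T`, `QuantumComplexity/CWrap*.lean`), with a last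
stage doing the exact finish of `RegevReductionCVPLiftExact.lean` (LLL, nearest plane, back-substitution,
offset-binary output); the good path `g` is the sequence of windows holding the TRUE iterates
`DigitOracle.iter q I (ratOf c) i` and true partial sums, whose last window starts with
`CVPOracle.answerTable I c` (`DigitOracle.coords_eq_of_isLLLReduced`); the per-stage bound `f i` is
`DigitOracle.failProb T q I ρ k y (x_i)` (the wrap is deterministic around `T`), and `f = 0` for the
finish.  Then `exists_chainFamily_goodPath` gives `R := D` with `C = 1`, `ν = 0`, `p_R = 2n` (the finish
stage contributes `f = 0`).
What this leaves: the stage family `S` and the verification that its kernel on a good window is the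
push-forward of `T`'s kernel on the true query (machine semantics of the classical wrap).

## References

* O. Regev, *On lattices, learning with errors, random linear codes, and cryptography*, J. ACM 56(6)
  (2009), Lemma 3.5 (p. 16 of the author's version arXiv:2401.03703). [Regev2009] [RegevLWE2009]
* E. Bernstein, U. Vazirani, *Quantum complexity theory*, SIAM J. Comput. 26 (1997), §8 (subroutine
  calls, error of composed machines). [BernsteinVazirani1997]
* M. A. Nielsen, I. L. Chuang, *Quantum Computation and Quantum Information*, CUP 2010, §4.4 (principle
  of deferred measurement). [NielsenChuang2010]
-/

noncomputable section

namespace Literature.Computability.Cryptography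

open Literature.Computability.QuantumComplexity Literature.Computability.Complexity
open scoped ENNReal

namespace Regev2009

/-! ### One bind: leaving the good point -/

/-- **One step of the union bound**: the probability that `p >>= K` misses `b₀` is at most the
probability that `p` misses `a₀` plus the probability that `K a₀` misses `b₀`. [folklore] -/
theorem toOuterMeasure_bind_ne_le {α β : Type*} (p : PMF α) (K : α → PMF β) (a₀ : α) (b₀ : β) :
    (p.bind K).toOuterMeasure {b | b ≠ b₀} ≤
      p.toOuterMeasure {a | a ≠ a₀} + (K a₀).toOuterMeasure {b | b ≠ b₀} := by
  classical
  rw [PMF.toOuterMeasure_bind_apply, ENNReal.tsum_eq_add_tsum_ite a₀, add_comm]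
  refine add_le_add ?_ ?_
  · rw [PMF.toOuterMeasure_apply p {a | a ≠ a₀}]
    refine ENNReal.tsum_le_tsum fun a => ?_
    by_cases ha : a = a₀
    · simp [ha]
    · rw [if_neg ha, Set.indicator_of_mem (show a ∈ {a | a ≠ a₀} from ha)]
      calc p a * (K a).toOuterMeasure {b | b ≠ b₀} ≤ p a * 1 :=
            mul_le_mul' le_rfl (Literature.Probability.Moments.pmf_toOuterMeasure_le_one _ _)
        _ = p a := mul_one _
  · calc p a₀ * (K a₀).toOuterMeasure {b | b ≠ b₀} ≤ 1 * (K a₀).toOuterMeasure {b | b ≠ b₀} :=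
          mul_le_mul' (PMF.coe_le_one p a₀) le_rfl
      _ = _ := one_mul _

/-! ### The good path of a chain of stages -/

/-- **The union bound along a good path of `chainLaw`** (Regev, proof of Lemma 3.5: the procedure is
correct unless one of its `n` oracle calls errs; in general: a chain of stages whose `k`-th stage, run on
the GOOD window `g k`, hands over the good window `g (k+1)` except with probability `≤ f k`, ends off the
good path with probability `≤ Σ_{k<N} f k`). [cite: Regev2009, Lemma 3.5 (proof); BernsteinVazirani1997, §8 (error of composed subroutine calls)] -/
theorem chainLaw_toOuterMeasure_ne_le_sum {G : QGateSet} (A : Language Bool) (F : QCircuitFamily G) (m : ℕ)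
    (x : List Bool) (g : ℕ → List Bool) (hg0 : g 0 = []) (f : ℕ → ℝ≥0∞)
    (hf : ∀ k, ((F.kernel A (stageInput x k (g k))).map fun w => w.takeD m false).toOuterMeasure
      {y | y ≠ g (k + 1)} ≤ f k) :
    ∀ N, (chainLaw A F m x N).toOuterMeasure {y | y ≠ g N} ≤ ∑ k ∈ Finset.range N, f k
  | 0 => by
    rw [chainLaw_zero, PMF.toOuterMeasure_pure_apply, if_neg (by simp [hg0])]
    exact bot_le
  | N + 1 => by
    rw [chainLaw_succ, Finset.sum_range_succ]
    exact (toOuterMeasure_bind_ne_le _ _ (g N) (g (N + 1))).trans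
      (add_le_add (chainLaw_toOuterMeasure_ne_le_sum A F m x g hg0 f hf N) (hf N))

/-- **Complement form**: the chain ends ON the good path with probability `≥ 1 − Σ_{k<N} f k`.
[cite: Regev2009, Lemma 3.5 (proof)] -/
theorem one_le_chainLaw_toOuterMeasure_add_sum {G : QGateSet} (A : Language Bool) (F : QCircuitFamily G) (m : ℕ)
    (x : List Bool) (g : ℕ → List Bool) (hg0 : g 0 = []) (f : ℕ → ℝ≥0∞)
    (hf : ∀ k, ((F.kernel A (stageInput x k (g k))).map fun w => w.takeD m false).toOuterMeasure
      {y | y ≠ g (k + 1)} ≤ f k) (N : ℕ) :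
    1 ≤ (chainLaw A F m x N).toOuterMeasure {g N} + ∑ k ∈ Finset.range N, f k := by
  have h := chainLaw_toOuterMeasure_ne_le_sum A F m x g hg0 f hf N
  have huniv : (chainLaw A F m x N).toOuterMeasure Set.univ = 1 :=
    ((chainLaw A F m x N).toOuterMeasure_apply_eq_one_iff Set.univ).2 (Set.subset_univ _)
  have hcover : (Set.univ : Set (List Bool)) ⊆ {g N} ∪ {y | y ≠ g N} := fun y _ => by
    by_cases hy : y = g N
    · exact Or.inl hy
    · exact Or.inr hy
  calc (1 : ℝ≥0∞) = (chainLaw A F m x N).toOuterMeasure Set.univ := huniv.symm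
    _ ≤ (chainLaw A F m x N).toOuterMeasure ({g N} ∪ {y | y ≠ g N}) :=
        (chainLaw A F m x N).toOuterMeasure.mono hcover
    _ ≤ (chainLaw A F m x N).toOuterMeasure {g N} + (chainLaw A F m x N).toOuterMeasure {y | y ≠ g N} :=
        MeasureTheory.measure_union_le _ _
    _ ≤ _ := add_le_add le_rfl h

/-! ### The chained uniform family: failure to print the good answer ≤ the sum of the stage failures -/

/-- **The loop principle with a good path** (Bernstein–Vazirani 1997 §8 / Nielsen–Chuang 2010 §4.4 as
the tree's `ChainCompose.exists_chainFamily`, combined with the union bound): for a uniform stage family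
`S` and polynomials `T` (stages) and `m` (window) there is ONE uniform family `D` such that, for every
input `x`, every good path `g` (`g 0 = []`) with per-stage failure bounds `f k` (in `ℝ`, via
`kernelProb`), and every string `a` that is a prefix of the last good window, `D` on `x` prints an
output starting with `a` except with probability `≤ Σ_{k<T(|x|)} f k`.  This is the probabilistic
half of Regev's Lemma 3.5 (`A_lift = regev2009_lemma_3_5_liftFamily` of `RegevReductionCVPSplit.lean`)
for ANY stage family; what it leaves to a prover of `A_lift` is the stage family itself (one call of
the digit solver between two exact classical computations) and the identification of its good path
(`RegevReductionCVPLiftExact.lean`). [cite: Regev2009, Lemma 3.5 (proof); BernsteinVazirani1997, §8; NielsenChuang2010, §4.4] -/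
theorem exists_chainFamily_goodPath (S : UniformQCircuitFamily) (T m : Polynomial ℕ) :
    ∃ D : UniformQCircuitFamily, ∀ (x : List Bool) (g : ℕ → List Bool) (_ : g 0 = []) (f : ℕ → ℝ)
      (_ : ∀ k, 0 ≤ f k)
      (_ : ∀ k < T.eval x.length,
        S.kernelProb (stageInput x k (g k)) {w | w.takeD (m.eval x.length) false ≠ g (k + 1)} ≤ f k)
      (a : List Bool) (_ : a <+: g (T.eval x.length)),
      1 - D.kernelProb x {z | a <+: z} ≤ ∑ k ∈ Finset.range (T.eval x.length), f k := by
  obtain ⟨D, hD⟩ := ChainCompose.exists_chainFamily S T m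
  refine ⟨D, fun x g hg0 f hf0 hf a ha => ?_⟩
  set N := T.eval x.length
  set mw := m.eval x.length
  -- per-stage failure bounds in `ℝ≥0∞`, stages beyond `N` bounded by `1`
  set f' : ℕ → ℝ≥0∞ := fun k => if k < N then ENNReal.ofReal (f k) else 1
  have hf' : ∀ k, ((S.family.kernel 0 (stageInput x k (g k))).map fun w => w.takeD mw false).toOuterMeasure
      {y | y ≠ g (k + 1)} ≤ f' k := by
    intro k
    by_cases hk : k < N
    · simp only [f', if_pos hk]
      have h1 := hf k hk
      rw [UniformQCircuitFamily.kernelProb_eq] at h1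
      rw [PMF.toOuterMeasure_map_apply, ← ENNReal.ofReal_toReal
        (ne_top_of_le_ne_top ENNReal.one_ne_top (Literature.Probability.Moments.pmf_toOuterMeasure_le_one _ _))]
      exact ENNReal.ofReal_le_ofReal h1
    · simp only [f', if_neg hk]
      exact Literature.Probability.Moments.pmf_toOuterMeasure_le_one _ _
  -- the chain ends on the good window except with probability `Σ f'`
  have hchain := one_le_chainLaw_toOuterMeasure_add_sum 0 S.family mw x g hg0 f' hf' N
  -- the chained family prints an extension of the good window at least as often
  have hDge : (chainLaw 0 S.family mw x N).toOuterMeasure {g N} ≤ (D.kernel x).toOuterMeasure {z | a <+: z} :=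
    (hD x {g N}).trans ((D.kernel x).toOuterMeasure.mono fun z hz => by
      obtain ⟨y, hy, hyz⟩ := hz
      rw [Set.mem_singleton_iff] at hy
      subst hy
      exact ha.trans hyz)
  have hsum : ∑ k ∈ Finset.range N, f' k = ∑ k ∈ Finset.range N, ENNReal.ofReal (f k) :=
    Finset.sum_congr rfl fun k hk => by simp only [f', if_pos (Finset.mem_range.1 hk)]
  have hkey : (1 : ℝ≥0∞) ≤ (D.kernel x).toOuterMeasure {z | a <+: z} + ∑ k ∈ Finset.range N, ENNReal.ofReal (f k) := by
    rw [← hsum]; exact hchain.trans (add_le_add hDge le_rfl)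
  -- pass to `ℝ`
  have hfin1 : (D.kernel x).toOuterMeasure {z | a <+: z} ≠ ⊤ :=
    ne_top_of_le_ne_top ENNReal.one_ne_top (Literature.Probability.Moments.pmf_toOuterMeasure_le_one _ _)
  have hfin2 : ∑ k ∈ Finset.range N, ENNReal.ofReal (f k) ≠ ⊤ :=
    ENNReal.sum_ne_top.2 fun k _ => ENNReal.ofReal_ne_top
  have hreal := (ENNReal.toReal_le_toReal ENNReal.one_ne_top (ENNReal.add_ne_top.2 ⟨hfin1, hfin2⟩)).2 hkey
  rw [ENNReal.toReal_one, ENNReal.toReal_add hfin1 hfin2, ENNReal.toReal_sum fun k _ => ENNReal.ofReal_ne_top,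
    Finset.sum_congr rfl fun k _ => ENNReal.toReal_ofReal (hf0 k)] at hreal
  rw [UniformQCircuitFamily.kernelProb_eq]
  linarith

end Regev2009


end Literature.Computability.Cryptography

end
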